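import Summits.SmoothPoincare4.SmoothPoincare4.Theses.ZeroSurgeryExotic
import Summits.SmoothPoincare4.SmoothPoincare4.Theses.NoOneHandles
import Literature.Topology.FourManifolds.SliceKnots
import Literature.Uncategorized.Crux
import Literature.Topology.FourManifolds.HomotopyBallSliceProofs
import Literature.Topology.FourManifolds.ZeroSurgeryHomotopyBallSliceHolds
import Literature.Topology.FourManifolds.DehnSurgeryProofs
import Literature.Topology.FourManifolds.KnotsProofs
import Literature.Topology.FourManifolds.KnotsIsotopyProofs
import Literature.Topology.FourManifolds.SliceRibbonIsotopyProofs
import Literature.Topology.FourManifolds.Rasmussen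
import Literature.Topology.FourManifolds.RasmussenConcordanceProofs
import Literature.Topology.FourManifolds.KirbyMovesReverseProofs
import Literature.Topology.FourManifolds.SliceGenusMirrorProofs
import Mathlib.Analysis.InnerProductSpace.Calculus
import Summits.SmoothPoincare4.SmoothPoincare4.Theorems.ZseSVanishesOnPairs.Negative.Position
import Summits.SmoothPoincare4.SmoothPoincare4.Theorems.ZseSVanishesOnPairs.Negative.MirrorClosure
import Summits.SmoothPoincare4.SmoothPoincare4.Theorems.ZseSVanishesOnPairs.Negative.LoadBearing

/-!
# Disproof of `ZseThesis` — findings (standing disprover, cdisprove gen 1, cycle 1, 2026-08-16)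

Crux `Summit.SmoothPoincare4.SmoothPoincare4.Theses.ZeroSurgeryExotic.ZseThesis` (item stmt-SmoothPoincare4-0364,
route ZeroSurgeryExotic, rank 0 — the route's TARGET, auto-badged crux):

  `∃ K K' Y, IsIntegralSurgery (𝓡 3) Y K 0 ∧ IsIntegralSurgery (𝓡 3) Y K' 0 ∧ K.IsSmoothlySlice ∧ ¬ K'.IsSmoothlySlice`

("some two knots with a common `0`-surgery, the first smoothly slice, the second not").

VERDICT OF THIS CYCLE: **no kill; the statement resists every cheap attack, and here is WHY, as checked Lean.**
Prose lives only in docstrings; every `theorem` below is kernel-checked unless it says `sorry` (§6 only).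

* §0 `¬ ZseThesis ↔ Assembly2` — a disproof of the crux is LITERALLY a proof of the route's kill switch
  (item 0367, "the `0`-surgery type of a knot determines its smooth sliceness"), an open problem in print
  (only the `0`-TRACE analogue is a theorem — trace embedding lemma; Manolescu's survey arXiv:2601.05425 §7).
* §1 POSITION. `SmoothPoincare4 → ¬ ZseThesis` (so the crux is refutable only by proving a consequence of the
  summit that is itself open), `¬ ZseHsliceNotSlice → ¬ ZseThesis` (the waypoint 0520 sits above it), and
  `ZseThesis →` an exotic `S⁴` (the MP + FGMW chain, both PROVED in the tree) — i.e. the crux is sandwiched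
  `Crux₀₃₆₆ ⇒(mod Rasmussen) ZseThesis ⇒ ZseHsliceNotSlice ⇒ ¬SPC4`, and dually
  `SPC4 ⇒ Assembly2 = ¬ZseThesis ⇒ SVanishesOnPairs (mod Rasmussen) / GluckLever` (sibling Negative files).
  Nothing strictly between `SPC4` and `Assembly2` is known in print: no junk escape, no cheap kill.
* §1b `Crux₀₃₆₆ → ZseThesis`, `¬ZseThesis → ¬Crux₀₃₆₆`, `Assembly2 → SVanishesOnPairs` (all mod Rasmussen's Theorem 1).
* §2 NO JUNK (read-back of the elaborated statement, on paper + Lean witnesses): `Knot` = bundled smooth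
  embedding `S¹ ↪ S³` (inhabited: `unknot`, instance `SphereEmbedding.smoothnessFacts`); `IsIntegralSurgery … 0`
  = genuine `0`-framed Dehn surgery as an open gluing (pushout pinned, so the `∃`-bound bare `ChartedSpace Y`
  without `IsManifold`/`T2Space` is harmless); `IsSmoothlySlice` = honest neat smooth disc in `B⁴`. The first
  three conjuncts are jointly satisfiable by TREE THEOREMS (`zseThesis_without_nonslice`), so the whole content
  is the last conjunct on a `0`-friend of a slice knot; deleting `K.IsSmoothlySlice` or the common `Y` makes the
  statement equivalent to "some knot is not slice" (§4) — true on paper (trefoil), in the tree only mod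
  Rasmussen's Theorem 1 (`eq_zero_of_isSmoothlySlice`, named fact; `s(T(2,3)) = 2` IS proved): the tree has NO
  unconditional theorem `¬ K.IsSmoothlySlice` for any knot yet (provers: a witness needs one end-to-end).
* §3 DEAD WITNESS SHAPES (unconditional): `K' = K`, `K'` isotopic to `K`, `K' = K̄` (every knot is a
  `0`-friend of its mirror in the tree's unoriented sense, `zeroSurgeryPair_self_mirror`, and sliceness is
  mirror-invariant), `K'` CONCORDANT to `K` — all impossible; equivalently (`zseThesis_iff_nonConcordantFriends`)
  the crux says: SOME SLICE KNOT HAS A NON-CONCORDANT `0`-FRIEND. Non-concordant `0`-friends exist in print — the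
  Akbulut–Kirby conjecture (Kirby Problem 1.19: homeomorphic `0`-surgeries ⇒ concordant) was disproved by Yasui
  (2015), and Miller–Piccirillo (2018) gave non-concordant knots with diffeomorphic `0`-TRACES (page-checked report:
  Piccirillo 2019, §1 p. 3; in those pairs neither knot is slice) — so the pair relation alone does not bound the
  concordance class: the obstruction to a disproof is real, not formal.
* §3b DEAD STRENGTHENINGS: "`K'` not even slice in a homotopy 4-ball" is FALSE unconditionally
  (`zseThesis_hballWitness_false`, Manolescu–Piccirillo Lemma 3.3 PROVED in the tree); "`K'` not TOPOLOGICALLY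
  slice" is false mod Freedman (`zseThesis_topWitness_false_of_freedman` = sibling `crux_topologicalWitness_false`).
  Hence the CERTIFICATION BARRIER for the positive side: whatever shows `¬ K'.IsSmoothlySlice` must be a
  smooth-only obstruction NOT factoring through homotopy-ball sliceness — in print that leaves the Khovanov
  family (`s`, `s_𝔽`, LEO `s̃_c`), whose homotopy-ball behaviour is MMSW Question 9.11 (open; catalogue
  `Literature/Barriers/SmoothPoincare4/GluckTwistsDissolve.lean`); τ, ε, ν⁺, Υ, signatures, Casson–Gordon all
  vanish on such `K'` (informal here — no Floer objects in the tree).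
* §3c MIRROR CLOSURE: witnesses come in mirror pairs (`zseThesis_witness_mirror`).
* §3d REVERSE CLOSURE (new tree content, unconditional): sliceness is reverse-invariant (`isSliceDisc_reverse`),
  `m`-surgery on `K` is `m`-surgery on `Kʳ` for the SAME `Y` (`isIntegralSurgery_reverse`, from the PROVED Kirby
  fact `FramedLink.IsSurgery.reverseComponent_holds`) — so `(K, Kʳ, Y)` and `(K, K̄ʳ, Y)` are ALWAYS `0`-pairs
  (Livingston's non-concordant reverse pairs, Abe–Tagami 2016 §1, are the simplest non-concordant `0`-friends in
  print) yet never witnesses; witnesses are closed under the Klein four-group `{1, mirror, reverse, inverse}`.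
* §4 LOAD-BEARING DELETIONS as theorems (`zseThesis_without_*`).
* §5 WEAKENING `K` merely homotopy-ball slice collapses onto the waypoint: `ZseHsliceNotSlice →` weak thesis
  (diagonal witness), so that variant carries no `0`-surgery content.
* §8 FRAMING FAMILY `ZseThesisFraming m`: `m = 0` is the crux; symmetric under `m ↦ -m` (unconditional);
  in print (Piccirillo 2019 §1 p.3, page-checked) the `n ≠ 0` members hold via diffeomorphic `n`-traces of a slice
  and a non-slice knot [Akb77, Lic79, …], so the `0` is load-bearing for a disproof; for `n = 0` the trace route is
  closed by [KM78] (trace embedding lemma).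
* §6 NEAR-MISS (sorried, OPEN): `Assembly2` itself — the only in-tree road to it is `SPC4` (§1).
* §6b NEAR-MISS WITH A PROOF ON PAPER (sorried: handle calculus absent): the RIBBON sub-case of the kill switch
  follows from route NoOneHandles' crux `NoohGscStandard` (0377; gsc-SPC4 = Weak Generalised Property R): for `K`
  ribbon the MP sphere `X₀(K') ∪ V` has a handle decomposition WITHOUT 1-HANDLES (`r` 2-handles, `r` 3-handles);
  hence `NoohGscStandard ∧ SliceRibbonConjecture → ¬ ZseThesis` — a witness of the crux is a gsc exotic `S⁴` or a
  slice-non-ribbon knot. This places the whole practical search space of the route inside the NoOneHandles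
  programme (every certified slice disc is ribbon).
* §7 WHY NO COMPUTATION: `¬ ZseThesis` is a `∀` over all knots; no finite model. The positive side is a search
  (certified `0`-surgery homeomorphism + ribbon disc + B⁴-only obstruction); nothing here obstructs it, §3 says
  where not to look (concordant / isotopic / mirror partners; special RBG families where `s` is forced to vanish:
  Nakamura 2023 Thm 3.13, Dunfield–Gong 2025 Thm 5.9; annulus-twist families of ribbon knots with good
  presentations, which stay ribbon: Abe–Jong–Omae–Takeuchi 2013).
* LITERATURE KILL-TEST (to 2026-08): no proof of "0-surgery determines sliceness", no positive answer to MMSW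
  Q9.11, no slice/non-slice 0-friend pair found (Manolescu survey arXiv:2601.05425 p.24; Kegel–Spreer
  arXiv:2603.22438 §6; Oliveira–Smith arXiv:2603.23717). Re-run quarterly.
-/

noncomputable section

set_option linter.dupNamespace false

open scoped Manifold ContDiff
open ContinuousMap Function Set
open Literature.Topology.FourManifolds Literature.Uncategorized
open Summit.SmoothPoincare4.SmoothPoincare4.Theses.ZeroSurgeryExotic
open Summit.SmoothPoincare4.SmoothPoincare4.Theorems.ZseSVanishesOnPairs.Negative

namespace Summit.SmoothPoincare4.SmoothPoincare4.Cruxes.ZseThesis.Disproof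

/-- Local notation: `𝔼 n` is `EuclideanSpace ℝ (Fin n)`. -/
local notation "𝔼 " n:arg => EuclideanSpace ℝ (Fin n)

/-- Local notation: `𝕊 n` is the unit sphere in `EuclideanSpace ℝ (Fin (n + 1))`. -/
local notation "𝕊 " n:arg => (Metric.sphere (0 : EuclideanSpace ℝ (Fin (n + 1))) 1)

-- buildfix 2026-08-19: the route item `Assembly2` (stmt-SmoothPoincare4-0367, the kill switch "the
-- `0`-surgery type determines smooth sliceness") was DROPPED from `Theses/ZeroSurgeryExotic.lean` on
-- 2026-08-16T14:15:59Z (moot), so the identifier vanished from the route namespace. Its body is kept here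
-- VERBATIM as local vocabulary so that every statement below reads (and elaborates) exactly as before.
/-- **Kill switch `Assembly2`** (body of the dropped route item stmt-SmoothPoincare4-0367, verbatim): the
`0`-surgery type determines smooth sliceness — if `K` and `K'` have homeomorphic `0`-surgeries and `K` is
smoothly slice then so is `K'`. -/
def Assembly2 : Prop :=
  ∀ (K K' : Literature.Topology.FourManifolds.Knot) (Y : Type) [TopologicalSpace Y]
    [ChartedSpace (EuclideanSpace ℝ (Fin 3)) Y],
    Literature.Topology.FourManifolds.IsIntegralSurgery (𝓡 3) Y K 0 →
    Literature.Topology.FourManifolds.IsIntegralSurgery (𝓡 3) Y K' 0 → K.IsSmoothlySlice → K'.IsSmoothlySlice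

/-! ## §0 The crux is exactly the negation of the kill switch -/

/-- `¬ ZseThesis` is, up to pushing the negation through, the route's kill switch `Assembly2`
("the `0`-surgery type determines smooth sliceness", item 0367). So DISPROVING the crux = PROVING 0367. -/
theorem not_zseThesis_iff_assembly2 : ¬ ZseThesis ↔ Assembly2 := by
  constructor
  · intro h K K' Y _ _ h1 h2 h3
    by_contra h4
    exact h ⟨K, K', Y, _, _, h1, h2, h3, h4⟩
  · rintro h ⟨K, K', Y, _, _, h1, h2, h3, h4⟩
    exact h4 (h K K' Y h1 h2 h3)

/-- Dually, the crux holds iff the kill switch fails. -/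
theorem zseThesis_iff_not_assembly2 : ZseThesis ↔ ¬ Assembly2 := by
  rw [← not_zseThesis_iff_assembly2, not_not]

/-! ## §1 Position: what a disproof costs and what a proof yields -/

/-- In any configuration of the crux the partner `K'` is slice in a homotopy 4-ball — Manolescu–Piccirillo
Lemma 3.3 for `W = S⁴`, PROVED in the tree (`Knot.ManolescuPiccirillo2023_lemma33_sphere_holds`, bridged to
`IsIntegralSurgery` by `isHomotopyBallSlice_of_zeroSurgeryPair`). -/
theorem partner_isHomotopyBallSlice {K K' : Knot} {Y : Type} [TopologicalSpace Y] [ChartedSpace (𝔼 3) Y]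
    (h1 : IsIntegralSurgery (𝓡 3) Y K 0) (h2 : IsIntegralSurgery (𝓡 3) Y K' 0) (h3 : K.IsSmoothlySlice) :
    K'.IsHomotopyBallSlice :=
  isHomotopyBallSlice_of_zeroSurgeryPair h1 h2 h3

/-- **`SmoothPoincare4` refutes the crux** (equivalently: SPC4 ⇒ kill switch 0367): the partner is slice in a
homotopy ball (MP 3.3, proved) hence slice under SPC4 (contrapositive of the FGMW lemma, proved via Palais).
So the crux can only be DISproved by establishing a consequence of the summit conjecture which is itself open
in print; no cheaper kill exists in the tree. -/
theorem zseThesis_false_of_spc4 (hS : _root_.SmoothPoincare4) : ¬ ZseThesis := by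
  rintro ⟨K, K', Y, _, _, h1, h2, h3, h4⟩
  exact h4 (isSmoothlySlice_of_isHomotopyBallSlice_of_spc4 hS (partner_isHomotopyBallSlice h1 h2 h3))

/-- `SmoothPoincare4` proves the kill switch (same content, positive phrasing of 0367's body). -/
theorem assembly2_of_spc4 (hS : _root_.SmoothPoincare4) : Assembly2 :=
  not_zseThesis_iff_assembly2.1 (zseThesis_false_of_spc4 hS)

/-- **A disproof of the waypoint 0520 disproves the crux**: every witness `(K, K', Y)` makes `K'` a knot
that is slice in a homotopy ball but not in `B⁴`. -/
theorem zseThesis_false_of_not_zseHsliceNotSlice (h : ¬ ZseHsliceNotSlice) : ¬ ZseThesis := by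
  rintro ⟨K, K', Y, _, _, h1, h2, h3, h4⟩
  exact h ⟨K', partner_isHomotopyBallSlice h1 h2 h3, h4⟩

/-- **What a PROOF of the crux yields**: a closed smooth 4-manifold homotopy equivalent but not
diffeomorphic to `S⁴` (MP 3.3 + FGMW, both proved) — the crux is not junk-provable either: a Lean proof of it
is a Lean disproof of the summit. -/
theorem exotic_of_zseThesis (h : ZseThesis) :
    ∃ (M : Type) (_ : TopologicalSpace M) (_ : T2Space M) (_ : SecondCountableTopology M)
      (_ : ChartedSpace (𝔼 4) M) (_ : IsManifold (𝓡 4) ∞ M) (_ : CompactSpace M),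
      Nonempty (M ≃ₕ 𝕊 4) ∧ IsEmpty (M ≃ₘ⟮𝓡 4, 𝓡 4⟯ 𝕊 4) := by
  obtain ⟨K, K', Y, _, _, h1, h2, h3, h4⟩ := h
  exact Knot.exists_exotic_of_isHomotopyBallSlice_not_isSmoothlySlice_holds
    ⟨K', partner_isHomotopyBallSlice h1 h2 h3, h4⟩

/-- Hence the crux refutes the summit (the route's assembly 0365, here only as a corollary for the record;
its landing is the prover's). -/
theorem not_spc4_of_zseThesis (h : ZseThesis) : ¬ _root_.SmoothPoincare4 :=
  fun hS ↦ zseThesis_false_of_spc4 hS h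

/-! ## §1b Position relative to the sibling cruxes 0366 / 0368 (mod Rasmussen's Theorem 1) -/

/-- Mod Rasmussen's Theorem 1 (`eq_zero_of_isSmoothlySlice`, named fact), the `s`-witness crux 0366
(`Literature.Uncategorized.Crux`) implies the bare thesis: `s(K') ≠ 0` certifies `¬ K'.IsSmoothlySlice`.
So every kill of `ZseThesis` kills 0366 too (`not_crux_of_not_zseThesis`). -/
theorem zseThesis_of_crux (hR : eq_zero_of_isSmoothlySlice) (h : Crux) : ZseThesis := by
  obtain ⟨K, K', Y, _, _, s, h1, h2, h3, h4, h5⟩ := h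
  exact ⟨K, K', Y, _, _, h1, h2, h3, fun h6 ↦ h5 (hR h4 h6)⟩

/-- Contrapositive: a disproof of the bare thesis (= `Assembly2`) settles the kill test 0368
(`SVanishesOnPairs`) positively, mod Rasmussen. (Sibling form with the body of `Assembly2` spelled out:
`Theorems/ZseSVanishesOnPairs/Negative/Position.lean`, `sVanishesOnPairs_of_zeroSurgeryDeterminesSliceness`.) -/
theorem not_crux_of_not_zseThesis (hR : eq_zero_of_isSmoothlySlice) (h : ¬ ZseThesis) : ¬ Crux :=
  fun hc ↦ h (zseThesis_of_crux hR hc)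

/-- The same in the vocabulary of the two kill switches: `Assembly2 → SVanishesOnPairs` (mod Rasmussen). -/
theorem sVanishesOnPairs_of_assembly2 (hR : eq_zero_of_isSmoothlySlice) (hA : Assembly2) : SVanishesOnPairs :=
  not_crux_iff_sVanishesOnPairs.1 (not_crux_of_not_zseThesis hR (not_zseThesis_iff_assembly2.2 hA))

/-! ## §2 No junk: the hypotheses side is inhabited by tree theorems -/

/-- The first three conjuncts are jointly satisfiable: `K = K' =` unknot, `Y = S³₀(unknot)` (existence of
Dehn surgery and sliceness of the unknot are tree theorems). So `¬ K'.IsSmoothlySlice` carries ALL the content. -/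
theorem zseThesis_without_nonslice :
    ∃ (K K' : Knot) (Y : Type) (_ : TopologicalSpace Y) (_ : ChartedSpace (𝔼 3) Y),
      IsIntegralSurgery (𝓡 3) Y K 0 ∧ IsIntegralSurgery (𝓡 3) Y K' 0 ∧ K.IsSmoothlySlice := by
  obtain ⟨Y, _, _, _, _, _, _, hY⟩ := exists_isIntegralSurgery_holds unknot 0
  exact ⟨unknot, unknot, Y, _, _, hY, hY, isSmoothlySlice_unknot⟩

/-- Even with the manifold-quality side conditions the `∃ Y` omits (`T2Space`, `SecondCountableTopology`,
`IsManifold (𝓡 3) ∞`, `CompactSpace`), the hypotheses side stays satisfiable — the omission is not where the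
difficulty (or any junk) lives. -/
theorem zseThesis_without_nonslice_closedManifold :
    ∃ (K K' : Knot) (Y : Type) (_ : TopologicalSpace Y) (_ : T2Space Y) (_ : SecondCountableTopology Y)
      (_ : ChartedSpace (𝔼 3) Y) (_ : IsManifold (𝓡 3) ∞ Y) (_ : CompactSpace Y),
      IsIntegralSurgery (𝓡 3) Y K 0 ∧ IsIntegralSurgery (𝓡 3) Y K' 0 ∧ K.IsSmoothlySlice := by
  obtain ⟨Y, _, _, _, _, _, _, hY⟩ := exists_isIntegralSurgery_holds unknot 0
  exact ⟨unknot, unknot, Y, _, ‹_›, ‹_›, _, ‹_›, ‹_›, hY, hY, isSmoothlySlice_unknot⟩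

/-! ## §3 Dead witness shapes (unconditional) -/

/-- The diagonal `K' = K` is contradictory. -/
theorem zseThesis_sameKnot_false :
    ¬ ∃ (K : Knot) (Y : Type) (_ : TopologicalSpace Y) (_ : ChartedSpace (𝔼 3) Y),
        IsIntegralSurgery (𝓡 3) Y K 0 ∧ IsIntegralSurgery (𝓡 3) Y K 0 ∧ K.IsSmoothlySlice ∧
          ¬ K.IsSmoothlySlice := by
  rintro ⟨K, Y, _, _, -, -, h3, h4⟩
  exact h4 h3

/-- An ISOTOPIC partner is contradictory (sliceness is an isotopy invariant — tree theorem
`Knot.IsSmoothlySlice.of_isIsotopic_holds`): witnesses are pairs of genuinely different knot types. -/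
theorem zseThesis_isotopicWitness_false :
    ¬ ∃ (K K' : Knot) (Y : Type) (_ : TopologicalSpace Y) (_ : ChartedSpace (𝔼 3) Y),
        IsIntegralSurgery (𝓡 3) Y K 0 ∧ IsIntegralSurgery (𝓡 3) Y K' 0 ∧ K.IsSmoothlySlice ∧
          ¬ K'.IsSmoothlySlice ∧ K.IsIsotopic K' := by
  rintro ⟨K, K', Y, _, _, -, -, h3, h4, h5⟩
  exact h4 (Knot.IsSmoothlySlice.of_isIsotopic_holds h5 h3)

/-- Same with the isotopy stated the other way round (symmetry of isotopy is a tree theorem). -/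
theorem zseThesis_isotopicWitness_false' :
    ¬ ∃ (K K' : Knot) (Y : Type) (_ : TopologicalSpace Y) (_ : ChartedSpace (𝔼 3) Y),
        IsIntegralSurgery (𝓡 3) Y K 0 ∧ IsIntegralSurgery (𝓡 3) Y K' 0 ∧ K.IsSmoothlySlice ∧
          ¬ K'.IsSmoothlySlice ∧ K'.IsIsotopic K := by
  rintro ⟨K, K', Y, _, _, -, -, h3, h4, h5⟩
  exact h4 (Knot.IsSmoothlySlice.of_isIsotopic_holds (SphereEmbedding.IsIsotopic.symm_holds h5) h3)

/-- **The MIRROR partner is contradictory** although `(K, K̄, Y)` ALWAYS satisfies the pair hypotheses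
(`zeroSurgeryPair_self_mirror`: the tree's `IsIntegralSurgery` is orientation-blind, `S³₀(K̄) = -S³₀(K)`):
sliceness is mirror-invariant (`isSmoothlySlice_mirror_iff`, proved via `g₄`). This is the one place where the
unoriented rendering of "same `0`-surgery" could have produced junk witnesses — it does not. -/
theorem zseThesis_mirrorWitness_false :
    ¬ ∃ (K : Knot) (Y : Type) (_ : TopologicalSpace Y) (_ : ChartedSpace (𝔼 3) Y),
        IsIntegralSurgery (𝓡 3) Y K 0 ∧ IsIntegralSurgery (𝓡 3) Y K.mirror 0 ∧ K.IsSmoothlySlice ∧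
          ¬ K.mirror.IsSmoothlySlice := by
  rintro ⟨K, Y, _, _, -, -, h3, h4⟩
  exact h4 ((isSmoothlySlice_mirror_iff K).2 h3)

/-- The mirror pair hypotheses really are always available (so the previous lemma is not vacuous):
for every knot there is a `Y` that is `0`-surgery on both `K` and `K̄`. -/
theorem mirrorPair_exists (K : Knot) :
    ∃ (Y : Type) (_ : TopologicalSpace Y) (_ : ChartedSpace (𝔼 3) Y),
      IsIntegralSurgery (𝓡 3) Y K 0 ∧ IsIntegralSurgery (𝓡 3) Y K.mirror 0 := by
  obtain ⟨Y, _, _, _, _, _, _, hY⟩ := exists_isIntegralSurgery_holds K 0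
  exact ⟨Y, _, _, zeroSurgeryPair_self_mirror hY⟩

/-- **A CONCORDANT partner is contradictory** (concordant to slice is slice — the tree's Fox–Milnor theorem
`Knot.IsConcordant.isSmoothlySlice`). -/
theorem zseThesis_concordantWitness_false :
    ¬ ∃ (K K' : Knot) (Y : Type) (_ : TopologicalSpace Y) (_ : ChartedSpace (𝔼 3) Y),
        IsIntegralSurgery (𝓡 3) Y K 0 ∧ IsIntegralSurgery (𝓡 3) Y K' 0 ∧ K.IsSmoothlySlice ∧
          ¬ K'.IsSmoothlySlice ∧ K'.IsConcordant K := by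
  rintro ⟨K, K', Y, _, _, -, -, h3, h4, h5⟩
  exact h4 (h5.isSmoothlySlice h3)

/-- Two slice knots are concordant (both are concordant to the unknot; concordance is an equivalence —
tree theorems `Knot.isSmoothlySlice_iff_isConcordant_unknot_holds`, `equivalence_isConcordant_holds`). -/
theorem isConcordant_of_isSmoothlySlice {K K' : Knot} (hK : K.IsSmoothlySlice) (hK' : K'.IsSmoothlySlice) :
    K'.IsConcordant K :=
  equivalence_isConcordant_holds.trans (Knot.isSmoothlySlice_iff_isConcordant_unknot_holds.1 hK')
    (equivalence_isConcordant_holds.symm (Knot.isSmoothlySlice_iff_isConcordant_unknot_holds.1 hK))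

/-- **REFORMULATION (unconditional): the crux says exactly that some smoothly slice knot has a
NON-CONCORDANT `0`-friend.** (`⇒`: a concordant partner would be slice; `⇐`: a slice partner would be
concordant to `K`.) Non-concordant `0`-friends are known in print: the Akbulut–Kirby conjecture (Kirby Problem
1.19, "homeomorphic `0`-surgeries ⇒ concordant") was disproved by Yasui (2015), and Miller–Piccirillo gave
non-concordant knots with diffeomorphic `0`-traces (as reported in Piccirillo 2019, §1 p. 3; there neither knot is
slice) — so the common `0`-surgery does NOT bound the concordance class: the difficulty of a disproof is genuine.
[cite: Piccirillo2019, §1 p. 3] -/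
theorem zseThesis_iff_nonConcordantFriends :
    ZseThesis ↔ ∃ (K K' : Knot) (Y : Type) (_ : TopologicalSpace Y) (_ : ChartedSpace (𝔼 3) Y),
      IsIntegralSurgery (𝓡 3) Y K 0 ∧ IsIntegralSurgery (𝓡 3) Y K' 0 ∧ K.IsSmoothlySlice ∧
        ¬ K'.IsConcordant K := by
  constructor
  · rintro ⟨K, K', Y, _, _, h1, h2, h3, h4⟩
    exact ⟨K, K', Y, _, _, h1, h2, h3, fun h5 ↦ h4 (h5.isSmoothlySlice h3)⟩
  · rintro ⟨K, K', Y, _, _, h1, h2, h3, h4⟩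
    exact ⟨K, K', Y, _, _, h1, h2, h3, fun h5 ↦ h4 (isConcordant_of_isSmoothlySlice h3 h5)⟩

/-- **Profile of a witness** (unconditional part): the partner is slice in a homotopy 4-ball, not slice in
`B⁴`, not concordant and not isotopic to `K`, and not isotopic to `K̄`. -/
theorem witness_profile {K K' : Knot} {Y : Type} [TopologicalSpace Y] [ChartedSpace (𝔼 3) Y]
    (h1 : IsIntegralSurgery (𝓡 3) Y K 0) (h2 : IsIntegralSurgery (𝓡 3) Y K' 0) (h3 : K.IsSmoothlySlice)
    (h4 : ¬ K'.IsSmoothlySlice) :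
    K'.IsHomotopyBallSlice ∧ ¬ K'.IsSmoothlySlice ∧ ¬ K'.IsConcordant K ∧ ¬ K.IsIsotopic K' ∧
      ¬ K.mirror.IsIsotopic K' :=
  ⟨partner_isHomotopyBallSlice h1 h2 h3, h4, fun h5 ↦ h4 (h5.isSmoothlySlice h3),
    fun h5 ↦ h4 (Knot.IsSmoothlySlice.of_isIsotopic_holds h5 h3),
    fun h5 ↦ h4 (Knot.IsSmoothlySlice.of_isIsotopic_holds h5 ((isSmoothlySlice_mirror_iff K).2 h3))⟩

/-- **MIRROR CLOSURE**: witnesses come in mirror pairs — `(K̄, K̄', Y)` is a witness whenever `(K, K', Y)`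
is (same `Y`: the pair relation is unoriented). -/
theorem zseThesis_witness_mirror {K K' : Knot} {Y : Type} [TopologicalSpace Y] [ChartedSpace (𝔼 3) Y]
    (h1 : IsIntegralSurgery (𝓡 3) Y K 0) (h2 : IsIntegralSurgery (𝓡 3) Y K' 0) (h3 : K.IsSmoothlySlice)
    (h4 : ¬ K'.IsSmoothlySlice) :
    IsIntegralSurgery (𝓡 3) Y K.mirror 0 ∧ IsIntegralSurgery (𝓡 3) Y K'.mirror 0 ∧
      K.mirror.IsSmoothlySlice ∧ ¬ K'.mirror.IsSmoothlySlice :=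
  ⟨(isIntegralSurgery_zero_mirror_iff K).2 h1, (isIntegralSurgery_zero_mirror_iff K').2 h2,
    (isSmoothlySlice_mirror_iff K).2 h3, fun h ↦ h4 ((isSmoothlySlice_mirror_iff K').1 h)⟩

/-! ## §3d Reverse closure (NEW tree content): every knot is a `0`-friend of its reverse; the reverse partner is dead -/

/-- **Sliceness does not see the string orientation**: a slice disc `f` for `K` gives the slice disc `f ∘ ρ`
for `K.reverse = K ∘ ρ|_{S¹}` (`ρ = reflectLastCLM 1`, a linear isometry of `ℝ²`). -/
theorem isSliceDisc_reverse {K : Knot} {f : 𝔼 2 → 𝔼 4} (h : K.IsSliceDisc f) :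
    K.reverse.IsSliceDisc (f ∘ reflectLastCLM 1) := by
  obtain ⟨hsmooth, hinj, himm, hin, hneat, hbd⟩ := h
  have hR : ∀ x : 𝔼 2, ‖reflectLastCLM 1 x‖ = ‖x‖ := norm_reflectLastCLM 1
  have hRball : ∀ x : 𝔼 2, x ∈ Metric.closedBall (0 : 𝔼 2) 1 →
      reflectLastCLM 1 x ∈ Metric.closedBall (0 : 𝔼 2) 1 := by
    intro x hx
    rw [mem_closedBall_zero_iff] at hx ⊢
    rwa [hR]
  have hdiff : Differentiable ℝ f := hsmooth.differentiable (by simp)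
  have hdiff2 : Differentiable ℝ (fun y ↦ ‖f y‖ ^ 2) := hdiff.norm_sq ℝ
  refine ⟨hsmooth.comp (reflectLastCLM 1).contDiff, ?_, ?_, ?_, ?_, ?_⟩
  · intro x hx y hy hxy
    exact reflectLastCLM_injective 1 (hinj (hRball x hx) (hRball y hy) hxy)
  · intro x hx
    rw [fderiv_comp x (hdiff _) (reflectLastCLM 1).differentiableAt, ContinuousLinearMap.fderiv]
    exact (himm _ (hRball x hx)).comp (reflectLastCLM_injective 1)
  · intro x hx
    exact hin _ (by rw [hR]; exact hx)
  · intro x hx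
    have hcomp : (fun y ↦ ‖(f ∘ reflectLastCLM 1) y‖ ^ 2) = (fun y ↦ ‖f y‖ ^ 2) ∘ reflectLastCLM 1 :=
      rfl
    rw [hcomp, fderiv_comp x (hdiff2 _) (reflectLastCLM 1).differentiableAt,
      ContinuousLinearMap.fderiv]
    exact hneat _ (by rw [hR]; exact hx)
  · intro x
    change f (reflectLastCLM 1 (x : 𝔼 2)) = _
    rw [← coe_reflectLast]
    exact hbd (reflectLast 1 x)

/-- `Kʳ` is smoothly slice iff `K` is. -/
theorem isSmoothlySlice_reverse_iff (K : Knot) : K.reverse.IsSmoothlySlice ↔ K.IsSmoothlySlice := by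
  have key : ∀ L : Knot, L.IsSmoothlySlice → L.reverse.IsSmoothlySlice :=
    fun L ⟨f, hf⟩ ↦ ⟨_, isSliceDisc_reverse hf⟩
  exact ⟨fun h ↦ by simpa using key K.reverse h, key K⟩

/-- Reversing the unique component of `(K, m)` gives `(Kʳ, m)` — same framing integer. -/
theorem single_reverseComponent (K : Knot) (m : ℤ) :
    (FramedLink.single K m).reverseComponent 0 = FramedLink.single K.reverse m := by
  simp only [FramedLink.reverseComponent, FramedLink.single]
  congr 1
  congr 1
  funext i
  rw [Subsingleton.elim i 0, update_self]

/-- **`m`-surgery on `K` is `m`-surgery on `Kʳ` for the SAME `Y`** (the PROVED Kirby fact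
`FramedLink.IsSurgery.reverseComponent_holds` through `FramedLink.isSurgery_single_iff`). Hence `(K, Kʳ, Y)`
ALWAYS satisfies the pair hypotheses — in print the remark behind Livingston's counterexample to the Akbulut–Kirby
conjecture (a knot not concordant to its reverse; Abe–Tagami 2016 §1): the simplest NON-CONCORDANT `0`-friends.
[cite: AbeTagami2016, §1] -/
theorem isIntegralSurgery_reverse {Y : Type} [TopologicalSpace Y] [ChartedSpace (𝔼 3) Y] {K : Knot} {m : ℤ}
    (h : IsIntegralSurgery (𝓡 3) Y K m) : IsIntegralSurgery (𝓡 3) Y K.reverse m := by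
  rw [← FramedLink.isSurgery_single_iff] at h ⊢
  rw [← single_reverseComponent]
  exact FramedLink.IsSurgery.reverseComponent_holds h 0

/-- **The REVERSE partner is contradictory** (although `(K, Kʳ, Y)` is always a `0`-pair). -/
theorem zseThesis_reverseWitness_false :
    ¬ ∃ (K : Knot) (Y : Type) (_ : TopologicalSpace Y) (_ : ChartedSpace (𝔼 3) Y),
        IsIntegralSurgery (𝓡 3) Y K 0 ∧ IsIntegralSurgery (𝓡 3) Y K.reverse 0 ∧ K.IsSmoothlySlice ∧
          ¬ K.reverse.IsSmoothlySlice := by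
  rintro ⟨K, Y, _, _, -, -, h3, h4⟩
  exact h4 ((isSmoothlySlice_reverse_iff K).2 h3)

/-- **The INVERSE partner `-K̄ = K̄ʳ` is contradictory** (it is a `0`-friend of `K` by mirror + reverse closure). -/
theorem zseThesis_inverseWitness_false :
    ¬ ∃ (K : Knot) (Y : Type) (_ : TopologicalSpace Y) (_ : ChartedSpace (𝔼 3) Y),
        IsIntegralSurgery (𝓡 3) Y K 0 ∧ IsIntegralSurgery (𝓡 3) Y K.mirror.reverse 0 ∧ K.IsSmoothlySlice ∧
          ¬ K.mirror.reverse.IsSmoothlySlice := by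
  rintro ⟨K, Y, _, _, -, -, h3, h4⟩
  exact h4 ((isSmoothlySlice_reverse_iff K.mirror).2 ((isSmoothlySlice_mirror_iff K).2 h3))

/-- The reverse / inverse pair hypotheses are always realised (no vacuity in the two previous lemmas). -/
theorem symmetricPairs_exist (K : Knot) :
    ∃ (Y : Type) (_ : TopologicalSpace Y) (_ : ChartedSpace (𝔼 3) Y),
      IsIntegralSurgery (𝓡 3) Y K 0 ∧ IsIntegralSurgery (𝓡 3) Y K.mirror 0 ∧
        IsIntegralSurgery (𝓡 3) Y K.reverse 0 ∧ IsIntegralSurgery (𝓡 3) Y K.mirror.reverse 0 := by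
  obtain ⟨Y, _, _, _, _, _, _, hY⟩ := exists_isIntegralSurgery_holds K 0
  exact ⟨Y, _, _, hY, (isIntegralSurgery_zero_mirror_iff K).2 hY, isIntegralSurgery_reverse hY,
    isIntegralSurgery_reverse ((isIntegralSurgery_zero_mirror_iff K).2 hY)⟩

/-- **Reverse closure of witnesses** (same `Y`). With `zseThesis_witness_mirror`: the Klein four-group
`{1, mirror, reverse, inverse}` acts on witnesses, and the partner of a witness is isotopic to none of the four
symmetric images of `K`. -/
theorem zseThesis_witness_reverse {K K' : Knot} {Y : Type} [TopologicalSpace Y] [ChartedSpace (𝔼 3) Y]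
    (h1 : IsIntegralSurgery (𝓡 3) Y K 0) (h2 : IsIntegralSurgery (𝓡 3) Y K' 0) (h3 : K.IsSmoothlySlice)
    (h4 : ¬ K'.IsSmoothlySlice) :
    IsIntegralSurgery (𝓡 3) Y K.reverse 0 ∧ IsIntegralSurgery (𝓡 3) Y K'.reverse 0 ∧
      K.reverse.IsSmoothlySlice ∧ ¬ K'.reverse.IsSmoothlySlice :=
  ⟨isIntegralSurgery_reverse h1, isIntegralSurgery_reverse h2, (isSmoothlySlice_reverse_iff K).2 h3,
    fun h ↦ h4 ((isSmoothlySlice_reverse_iff K').1 h)⟩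

/-! ## §3b Dead strengthenings of the witness clause -/

/-- **"`K'` is not even slice in a homotopy 4-ball" is FALSE** — unconditionally (MP 3.3, proved). The ONLY
daylight left for the crux is the gap `IsHomotopyBallSlice ∖ IsSmoothlySlice`, i.e. an exotic homotopy
4-ball: the crux is precisely an instance of `¬ SPC4`, never anything weaker. -/
theorem zseThesis_hballWitness_false :
    ¬ ∃ (K K' : Knot) (Y : Type) (_ : TopologicalSpace Y) (_ : ChartedSpace (𝔼 3) Y),
        IsIntegralSurgery (𝓡 3) Y K 0 ∧ IsIntegralSurgery (𝓡 3) Y K' 0 ∧ K.IsSmoothlySlice ∧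
          ¬ K'.IsHomotopyBallSlice := by
  rintro ⟨K, K', Y, _, _, h1, h2, h3, h4⟩
  exact h4 (partner_isHomotopyBallSlice h1 h2 h3)

/-- **"`K'` is not TOPOLOGICALLY slice" is FALSE mod Freedman** (`hF`: a homotopy 4-ball is homeomorphic to
`B⁴`, Freedman 1982 Thm 1.6 — spelled-out hypothesis, not a tree fact) — verbatim the sibling lemma
`crux_topologicalWitness_false` (Theorems/ZseCruxRasmussen/Negative/TopologicalProfile.lean). Consequence for
the positive side: no topological concordance invariant can certify the partner. -/
theorem zseThesis_topWitness_false_of_freedman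
    (hF : ∀ K : Knot, K.IsHomotopyBallSlice → K.IsTopologicallySlice) :
    ¬ ∃ (K K' : Knot) (Y : Type) (_ : TopologicalSpace Y) (_ : ChartedSpace (𝔼 3) Y),
        IsIntegralSurgery (𝓡 3) Y K 0 ∧ IsIntegralSurgery (𝓡 3) Y K' 0 ∧ K.IsSmoothlySlice ∧
          ¬ K'.IsTopologicallySlice := by
  rintro ⟨K, K', Y, _, _, h1, h2, h3, h4⟩
  exact h4 (hF K' (partner_isHomotopyBallSlice h1 h2 h3))

/-- Mod Freedman, every witness partner is topologically slice (positive phrasing). -/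
theorem witness_isTopologicallySlice_of_freedman
    (hF : ∀ K : Knot, K.IsHomotopyBallSlice → K.IsTopologicallySlice)
    {K K' : Knot} {Y : Type} [TopologicalSpace Y] [ChartedSpace (𝔼 3) Y]
    (h1 : IsIntegralSurgery (𝓡 3) Y K 0) (h2 : IsIntegralSurgery (𝓡 3) Y K' 0) (h3 : K.IsSmoothlySlice) :
    K'.IsTopologicallySlice :=
  hF K' (partner_isHomotopyBallSlice h1 h2 h3)

/-! ## §4 Load-bearing deletions: without `K` slice / without the common `Y`, the crux is "some knot is not slice" -/

/-- Deleting `K.IsSmoothlySlice`: the remaining statement is EQUIVALENT to "some knot is not smoothly slice"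
(diagonal witness `K = K'`, `Y = S³₀(K')`). -/
theorem zseThesis_without_slice_iff :
    (∃ (K K' : Knot) (Y : Type) (_ : TopologicalSpace Y) (_ : ChartedSpace (𝔼 3) Y),
        IsIntegralSurgery (𝓡 3) Y K 0 ∧ IsIntegralSurgery (𝓡 3) Y K' 0 ∧ ¬ K'.IsSmoothlySlice) ↔
      ∃ K' : Knot, ¬ K'.IsSmoothlySlice := by
  constructor
  · rintro ⟨-, K', -, -, -, -, -, h⟩
    exact ⟨K', h⟩
  · rintro ⟨K', h⟩
    obtain ⟨Y, _, _, _, _, _, _, hY⟩ := exists_isIntegralSurgery_holds K' 0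
    exact ⟨K', K', Y, _, _, hY, hY, h⟩

/-- Deleting the COMMON surgery (two unrelated `Y`, `Y'`): again EQUIVALENT to "some knot is not slice"
(`K =` unknot). So the coupling through one `Y` is the entire difficulty. -/
theorem zseThesis_without_commonSurgery_iff :
    (∃ (K K' : Knot) (Y : Type) (_ : TopologicalSpace Y) (_ : ChartedSpace (𝔼 3) Y)
        (Y' : Type) (_ : TopologicalSpace Y') (_ : ChartedSpace (𝔼 3) Y'),
        IsIntegralSurgery (𝓡 3) Y K 0 ∧ IsIntegralSurgery (𝓡 3) Y' K' 0 ∧ K.IsSmoothlySlice ∧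
          ¬ K'.IsSmoothlySlice) ↔
      ∃ K' : Knot, ¬ K'.IsSmoothlySlice := by
  constructor
  · rintro ⟨-, K', -, -, -, -, -, -, -, -, -, h⟩
    exact ⟨K', h⟩
  · rintro ⟨K', h⟩
    obtain ⟨Y, _, _, _, _, _, _, hY⟩ := exists_isIntegralSurgery_holds unknot 0
    obtain ⟨Y', _, _, _, _, _, _, hY'⟩ := exists_isIntegralSurgery_holds K' 0
    exact ⟨unknot, K', Y, _, _, Y', _, _, hY, hY', isSmoothlySlice_unknot, h⟩

/-- Deleting ONE of the two surgery conjuncts (`Y` constrains only `K`): equivalent to "some knot is not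
slice" as well. -/
theorem zseThesis_without_surgeryRight_iff :
    (∃ (K K' : Knot) (Y : Type) (_ : TopologicalSpace Y) (_ : ChartedSpace (𝔼 3) Y),
        IsIntegralSurgery (𝓡 3) Y K 0 ∧ K.IsSmoothlySlice ∧ ¬ K'.IsSmoothlySlice) ↔
      ∃ K' : Knot, ¬ K'.IsSmoothlySlice := by
  constructor
  · rintro ⟨-, K', -, -, -, -, -, h⟩
    exact ⟨K', h⟩
  · rintro ⟨K', h⟩
    obtain ⟨Y, _, _, _, _, _, _, hY⟩ := exists_isIntegralSurgery_holds unknot 0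
    exact ⟨unknot, K', Y, _, _, hY, isSmoothlySlice_unknot, h⟩

/-- "Some knot is not slice" holds mod Rasmussen's Theorem 1 (`eq_zero_of_isSmoothlySlice`, named fact of the
tree, NOT discharged): `s(T(2,3)) = 2` is an unconditional tree theorem (`hasRasmussenInvariant_trefoil_two`).
The tree has no unconditional `¬ K.IsSmoothlySlice` yet — recorded for provers: any witness of the crux needs
such a theorem end-to-end (a certified B⁴-sliceness obstruction). -/
theorem exists_not_isSmoothlySlice_of_rasmussen (hR : eq_zero_of_isSmoothlySlice) :
    ∃ K' : Knot, ¬ K'.IsSmoothlySlice :=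
  ⟨_, fun h ↦ two_ne_zero (hR hasRasmussenInvariant_trefoil_two h)⟩

/-- So, mod Rasmussen, each deletion of §4 turns the crux into a theorem: every remaining hypothesis is
load-bearing, and the statement is not junk-false. -/
theorem zseThesis_without_slice_of_rasmussen (hR : eq_zero_of_isSmoothlySlice) :
    ∃ (K K' : Knot) (Y : Type) (_ : TopologicalSpace Y) (_ : ChartedSpace (𝔼 3) Y),
      IsIntegralSurgery (𝓡 3) Y K 0 ∧ IsIntegralSurgery (𝓡 3) Y K' 0 ∧ ¬ K'.IsSmoothlySlice :=
  zseThesis_without_slice_iff.2 (exists_not_isSmoothlySlice_of_rasmussen hR)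

/-! ## §5 The weakening "`K` merely homotopy-ball slice" collapses onto the waypoint 0520 -/

/-- If some knot is slice in a homotopy ball but not in `B⁴` (waypoint `ZseHsliceNotSlice`, item 0520), the
WEAKENED crux with `K.IsHomotopyBallSlice` in place of `K.IsSmoothlySlice` holds by the diagonal witness
`K = K'` — that variant carries no `0`-surgery information, so the SMOOTH sliceness of `K` (a genuine `B⁴`)
is what couples the pair: any proof of the crux's negation must use the standard ball bounding `S³₀(K)`'s
trace side, cf. `LoadBearing`-type lemmas of the sibling cruxes. -/
theorem weakThesis_of_zseHsliceNotSlice (h : ZseHsliceNotSlice) :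
    ∃ (K K' : Knot) (Y : Type) (_ : TopologicalSpace Y) (_ : ChartedSpace (𝔼 3) Y),
      IsIntegralSurgery (𝓡 3) Y K 0 ∧ IsIntegralSurgery (𝓡 3) Y K' 0 ∧ K.IsHomotopyBallSlice ∧
        ¬ K'.IsSmoothlySlice := by
  obtain ⟨K, hK, hns⟩ := h
  obtain ⟨Y, _, _, _, _, _, _, hY⟩ := exists_isIntegralSurgery_holds K 0
  exact ⟨K, K, Y, _, _, hY, hY, hK, hns⟩

/-- Conversely the crux implies the waypoint (MP 3.3), so `ZseThesis → weak thesis` factors through 0520. -/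
theorem zseHsliceNotSlice_of_zseThesis (h : ZseThesis) : ZseHsliceNotSlice := by
  obtain ⟨K, K', Y, _, _, h1, h2, h3, h4⟩ := h
  exact ⟨K', partner_isHomotopyBallSlice h1 h2 h3, h4⟩

/-! ## §8 The framing parameter: the family is symmetric under `m ↦ -m` (unconditional) -/

/-- The thesis with framing `m` in place of `0` ("some `m`-surgery pair with `K` slice, `K'` not"). For `m = 0`
this is `ZseThesis` verbatim (`zseThesisFraming_zero_iff`). STATUS IN PRINT for `m ≠ 0` (page-checked:
Piccirillo, *Shake genus and slice genus*, Geom. Topol. 23 (2019), §1 p. 3): "for `n ≠ 0` such examples are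
well-known [Akb77, Lic79, Akb93, AJOT13, CR16]. All of these examples rely on the same proof technique: produce two
knots `K` and `K'` with `X_n(K)` diffeomorphic to `X_n(K')`, then show that `g₄(K) ≠ g₄(K')`" — diffeomorphic
`n`-traces have diffeomorphic boundaries `S³_n(K) ≅ S³_n(K')`, and in the shake-SLICE instances (Akbulut 1977,
Lickorish 1979: "`n`-shake slice but not slice") `g₄(K) = 0 < g₄(K')`, i.e. `ZseThesisFraming n` holds on paper for
those `n ≠ 0`. Same page: "[KM78] ... if a knot `K` shares a `0`-trace with a slice knot `K'` then `K` is slice" (the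
trace embedding lemma), so for `m = 0` the trace route is closed and only genuine `0`-SURGERY homeomorphisms not
extending over traces can witness the crux. CONSEQUENCE: the `0` is load-bearing for any DISPROOF — a proof of
`Assembly2` must use framing `0` (the only framing for which the Manolescu–Piccirillo manifold `X_m(K') ∪ V` is a
homotopy sphere), as the sibling lemma `zseSVanishesOnPairs_framing_false_of_commonSurgery_unknot_trefoil` records
for 0368. (Not formalisable here: the tree has no knot traces as 4-manifolds with boundary.) [cite: Piccirillo2019, §1 p. 3] -/
def ZseThesisFraming (m : ℤ) : Prop :=
  ∃ (K K' : Knot) (Y : Type) (_ : TopologicalSpace Y) (_ : ChartedSpace (𝔼 3) Y),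
    IsIntegralSurgery (𝓡 3) Y K m ∧ IsIntegralSurgery (𝓡 3) Y K' m ∧ K.IsSmoothlySlice ∧ ¬ K'.IsSmoothlySlice

/-- `m = 0` is the crux, syntactically. -/
theorem zseThesisFraming_zero_iff : ZseThesisFraming 0 ↔ ZseThesis := Iff.rfl

/-- One step of the symmetry: a framing-`m` witness mirrors to a framing-`(-m)` witness with the same `Y`
(`isIntegralSurgery_mirror`: `m`-surgery on `K` is `(-m)`-surgery on `K̄` for the same unoriented `Y`; sliceness
is mirror-invariant). -/
theorem zseThesisFraming_neg_of (m : ℤ) (h : ZseThesisFraming m) : ZseThesisFraming (-m) := by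
  obtain ⟨K, K', Y, _, _, h1, h2, h3, h4⟩ := h
  exact ⟨K.mirror, K'.mirror, Y, _, _, isIntegralSurgery_mirror h1, isIntegralSurgery_mirror h2,
    (isSmoothlySlice_mirror_iff K).2 h3, fun h ↦ h4 ((isSmoothlySlice_mirror_iff K').1 h)⟩

/-- **The framing family is symmetric under `m ↦ -m`** (unconditional): only `|m|` matters. -/
theorem zseThesisFraming_neg_iff (m : ℤ) : ZseThesisFraming (-m) ↔ ZseThesisFraming m :=
  ⟨fun h ↦ by simpa using zseThesisFraming_neg_of (-m) h, zseThesisFraming_neg_of m⟩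

/-! ## §6 Near-miss: the kill switch itself (OPEN) -/

/-- **THE KILL (open).** "The `0`-surgery type of a knot determines its smooth sliceness." In print: only the
`0`-TRACE version is a theorem (trace embedding lemma: `X₀(K) ≅ X₀(K') ⇒ (K slice ↔ K' slice)`); for
`0`-SURGERIES the statement is implied by SPC4 (`assembly2_of_spc4`) and by nothing weaker that is known.
Obstruction to closing it here: §3 (`zseThesis_iff_nonConcordantFriends`) — the common `0`-surgery does not
control the smooth concordance class, so a proof must use the slice DISC of `K` (not just invariants of `K`)
and produce a disc for `K'` inside the GENUINE `B⁴`; the MP construction produces it only inside the homotopy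
ball `Σ ∖ B̊⁴`, and recognising `Σ ≅ S⁴` is SPC4 for the `0`-surgery-born spheres (no 1-handles when `K` is
ribbon: `Σ = X₀(K') ∪ V` has a handle decomposition with `r` 2- and `r` 3-handles, `r` = number of minima of
the ribbon disc — the Property-2R / Andrews–Curtis-flavoured corner of SPC4, open for `r ≥ 2`; for `r = 1`,
i.e. `V ≅ S¹ × B³`, `Σ` is standard by Property R, but then `S³₀(K) = S¹ × S²` forces `K = K' =` unknot by
Gabai, so that case is empty). Tried: SPC4-free routes via (a) concordance (dead, §3), (b) topological
category (gives only TOP-sliceness of `K'`, §3b), (c) the mirror degeneracy of the unoriented pair relation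
(no junk, §3). -/
theorem assembly2_nearMiss : Assembly2 := by
  sorry

/-! ## §6b Near-miss: the RIBBON sub-case reduces to route NoOneHandles' crux C2 (OPEN, informal proof recorded) -/

/-- **THE RIBBON SUB-CASE OF THE KILL SWITCH FOLLOWS FROM `NoohGscStandard`** (item stmt-SmoothPoincare4-0377 of
route NoOneHandles: every homotopy 4-sphere carrying a Morse function without index-1 critical points is `S⁴`;
= SPC4 for geometrically simply connected homotopy spheres = Weak Generalised Property R, GST 2010 Prop. 9.2).
INFORMAL PROOF (standard handle bookkeeping, not formalisable now — the tree's Manolescu–Piccirillo construction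
`Knot.ManolescuPiccirillo2023_lemma33_sphere_construction` is built from collars, not handles, and knot traces /
ribbon-disc exteriors as handlebodies do not exist in the tree): let `D ⊂ B⁴` be a RIBBON disc for `K` with `r`
minima and `r - 1` saddles; its exterior `V = B⁴ ∖ ν(D)` has a handle decomposition with one 0-handle, `r`
1-handles (dotted circles) and `r - 1` 2-handles (Gompf–Stipsicz §6.2). The MP sphere is `Σ = X₀(K') ∪_Y V`;
building `Σ` from `X₀(K') = h⁰ ∪ h²` and then `V` attached along all of `∂V = Y` turns `V`'s handles upside down
(`k ↦ 4 - k`): `Σ = h⁰ ∪ (1 + (r-1))·h² ∪ r·h³ ∪ h⁴` — NO 1-HANDLES, i.e. `Σ` carries a self-indexing Morse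
function with `criticalSetOfIndex 1 = ∅`. So `NoohGscStandard` gives `Σ ≅ S⁴`, and Palais (PROVED,
`isSmoothlySlice_of_isSliceDiscIn_of_diffeomorph_sphere`-type lemmas of the tree) makes `K'` slice in `B⁴`.
CONSEQUENCE (`zseThesis_cost_nearMiss`): a witness of the crux is EITHER a geometrically simply connected exotic
`S⁴` (killing 0377 and Weak Generalised Property R) OR comes with a slice knot `K` admitting no ribbon disc
(killing the slice–ribbon conjecture `SliceRibbonConjecture`). Since every slice disc ever certified by computer
search is ribbon (band moves), the practical search space of the route lies entirely inside the NoOneHandles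
programme. [cite: GompfStipsicz1999, §6.2] -/
theorem assembly2_ribbon_of_noohGscStandard_nearMiss
    (hC2 : Summit.SmoothPoincare4.SmoothPoincare4.Theses.NoOneHandles.NoohGscStandard) :
    ∀ (K K' : Knot) (Y : Type) [TopologicalSpace Y] [ChartedSpace (𝔼 3) Y],
      IsIntegralSurgery (𝓡 3) Y K 0 → IsIntegralSurgery (𝓡 3) Y K' 0 → K.IsRibbon → K'.IsSmoothlySlice := by
  sorry

/-- **Cost of a witness, second form** (sorried only through the previous near-miss): geometrically-simply-connected
SPC4 (`NoohGscStandard`, item 0377) together with the slice–ribbon conjecture kill the crux. Equivalently a witness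
refutes one of the two. [cite: GompfStipsicz1999, §6.2] -/
theorem zseThesis_cost_nearMiss
    (hC2 : Summit.SmoothPoincare4.SmoothPoincare4.Theses.NoOneHandles.NoohGscStandard)
    (hSR : SliceRibbonConjecture) : ¬ ZseThesis := by
  rintro ⟨K, K', Y, _, _, h1, h2, h3, h4⟩
  exact h4 (assembly2_ribbon_of_noohGscStandard_nearMiss hC2 K K' Y h1 h2 (hSR K h3))

end Summit.SmoothPoincare4.SmoothPoincare4.Cruxes.ZseThesis.Disproof

end
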